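/-
Copyright: lit-balaban READER/TYPER seat r18 (gen 10; v1.1 gen 10).  Statement-level skeleton of a published paper; no proof claims beyond what
the kernel checks below.
-/
import Literature.MathematicalPhysics.QuantumFieldTheory.BalabanImbrieJaffe1984to88.BIJ85CurlyDkDecayTorus
import Literature.MathematicalPhysics.QuantumFieldTheory.BalabanImbrieJaffe1984to88.BIJ88Eq210Torus
import Literature.MathematicalPhysics.QuantumFieldTheory.BalabanImbrieJaffe1984to88.BIJ88Cutoffs21
import Literature.MathematicalPhysics.QuantumFieldTheory.BalabanImbrieJaffe1984to88.BIJ88HolderDecay213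
import Literature.MathematicalPhysics.QuantumFieldTheory.BalabanImbrieJaffe1984to88.BIJ85Ineq723Torus
import Literature.MathematicalPhysics.QuantumFieldTheory.BalabanImbrieJaffe1984to88.BIJ88ClocEstimatesTorus

/-!
# `BalabanImbrieJaffe1984to88.BIJ88CurlyDkLocTorus` — T. Bałaban, J. Imbrie, A. Jaffe, *Effective action and cluster properties of the
abelian Higgs model*, Commun. Math. Phys. **114** (1988) 257–315 [BalabanImbrieJaffe1988], Sect. 2 p. 261 [PDF 5]: **THE LOCALIZED
PROPAGATOR (2.12) `𝒟_{k,loc} = Σ_{j<k} H_{j,loc}C^{(j)}_{loc}H*_{j,loc}` OF RECORD ON THE TORI OF THE SERIES, WITH BODIES** — the truncated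
covariance (2.8) `C̃^{(j)}`, the localized covariance (2.9) `C^{(j)}_{loc} = (I − Q^{s*}Q)C̃^{(j)}(I − Q*Q^s)`, the localized minimizers
(2.4) `H_{j,loc}` at every scale, and the kernel of (2.12) — for the operators of record of the torus files (p11's `CE`, `HkE`; p31's/p02's
concrete `Q`, `Q*`, `Q^s`, `Q^{s*}`; p13's cutoffs), and the unnumbered display of p. 261 *"𝒟_{k,loc}(b₁,b₂) = 0 for dist(b₁,b₂) ≧ ½r(e_k)"*
PROVED for this concrete object (up to the one-block spread of the (2.9) sandwich, below).

statement-level skeleton of published theorems with citation tags; proofs where landed; nothing here is a claim about the Yang–Mills mass gap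

PDF held: `paper:balaban1988-cmp114-bij-abelian-higgs-effective-action` (journal page = PDF page + 256), p. 261 [PDF 5] (text layer
`~/.lit/texts/paper-balaban1988-cmp114-bij-abelian-higgs-effective-action/p0005.txt` materialised and re-read this session); [I] =
[BalabanImbrieJaffe1985] p. 312 [PDF 14] (4.4.4), p. 304 [PDF 6] (2.13)–(2.17).

CITATION HEADER (lean-in-tree rule).  Part of the lit-balaban TYPED SKELETON (HOME `run/shared/lean/pub/lit-balaban/`), READER/TYPER seat
r18 = the C2 §§1–4 fold owner and cross-paper DEFINITIONS typer (unit `lit-balaban-r18`, gen 10; TAKING line HOME/STATUS.md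
2026-08-21T20:5xZ).  Rows served: the DEF rows **C2.Eq2.8**, **C2.Eq2.9**, **C2.Eq2.12** of `HOME/lit-balaban-r18/ROWS-C2.md` (typed abstractly
in r18's `BIJ88Sect2Statements.trunc/cLoc/curlyDloc`, p239939) — here their TORUS INSTANCES for the operators of record — and the unnumbered
p. 261 clause of row **C2.Eq2.13** («𝒟_{k,loc}(b₁,b₂) = 0 for dist(b₁,b₂) ≧ ½r(e_k)», proved abstractly by p08's
`BIJ88MultiscaleDecay223.vanishes213_typed` / `BIJ88HolderDecay213.vanishes213_of_scales`).  Answer to p08 gen 8's note (HOME/lit-balaban-r18/INBOX.md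
2026-08-21T19:29:22Z) *"a torus 𝒟_{k,loc} still needs H_{j,loc}/C^{(j)}_{loc} at every scale (your DEF rows C2.Eq2.8/2.9/2.12)"*.  Decls used BY
NAME (nothing restated): p11's `BIJ85Prop522Torus.CE/HkE` and `BIJ85Prop521Torus.toEj` (the (4.3.3)/(4.4.2) operators of record; kernel
conventions of p08's `BIJ85CurlyDkDecayTorus.dkKernel_eq_sum`), p31's `BIJ85Eq213Adjoint.qKer/qstKer/runCount` ([I] (2.13)/(2.14)), p02's
`BIJ88Eq211Proof.qsKer/qsstKer/clocKer` ([I] (2.16)/(2.17), (2.9)), r15's `BIJ85Sect2SurfaceAverages.BlockBonds.Bs/mem_Bs` with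
`BIJ85Eq219Proof.torusBlockBonds` ([I] (2.15)), p31's `BIJ88Eq210Torus.qKer_mul_clocKer/clocKer_mul_qstKer` ((2.10)), p13's
`BIJ88Cutoffs21.cutoff` ((2.1)), p09's `BIJ85Ineq722Torus.distEU/ctr/supDist_ctr_ctr/supDist_triangle/supDist_runSite_le` and
`BIJ85Ineq723Torus.supDist_le_of_blockOf_eq`, p08's `BIJ88HolderDecay213.rLen_scale_le` ((2.2)–(2.3)), r18's
`BIJ88Sect2Statements.trunc/loc/Vanishes/rLen/eK`.

THE PRINTED TEXT (p. 261 [PDF 5], verbatim).  *"Next we consider C^{(k)}, the covariance of the k-th step gauge field. This is defined on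
the unit lattice T^{(k)}_{0,1}. First define C̃^{(k)}(b₁,b₂) = C^{(k)}(b₁,b₂), if dist(b₁,b₂) ≦ ¼r(e_k), 0, otherwise, (2.8) and extend by
translation invariance to T₁^{(k)}. Then put C^{(k)}_{loc} = (I − Q^{s*}Q)C̃^{(k)}(I − Q*Q^s); (2.9) this insures that C^{(k)}_{loc}, like
C^{(k)}, satisfies the constraints from the renormalization transformation and from the axial gauge conditions: QC^{(k)}_{loc} =
C^{(k)}_{loc}Q* = 0, (2.10) … These operators are used to define a localized propagator for the full gauge field at the k-th step:
𝒟_{k,loc} = Σ_{j=0}^{k−1} H^{L^jη}_{j,loc}C^{(j),L^jη}_{loc}H^{*L^jη}_{j,loc} ≡ Σ_{j=0}^{k−1} G^{(j),η}_{loc}. (2.12) Superscripts L^jη, η, etc.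
indicate the lattice spacing for operators rescaled to nonstandard lattices. This propagator derives its regularity and decay from that
of C^{(j)}_{loc} and H_{k,loc}. Thus |(𝒟_{k,loc}f)(b)| ≦ ce^{−c dist(supp f, b)}‖f‖_∞ (2.13) and similarly for derivatives of 𝒟_{k,loc} and
Hölder derivatives of order less than 2. Furthermore, 𝒟_{k,loc}(b₁,b₂) = 0 for dist(b₁,b₂) ≧ ½r(e_k), and 𝒟_{k,loc} is close to 𝒟_k, see
(5.4.3) below."*  p. 260: *"ζ_k(b,b′) = 0, if dist(b,b′) ≧ ⅛r(e_k), 1, if dist(b,b′) ≦ (1/16)r(e_k), (2.1) … H_{k,loc}(b,b′) =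
ζ_k(b,b′)H_k(b,b′). (2.4)"*; (2.2) `e_k = (L^kε)^{(4−d)/2}e`, (2.3) `r(e_k) = |log e_k⁻¹|^r`, `r > 1`.  [I] p. 312: *"Let 𝒟_k =
Σ_{j=0}^{k−1} H_jC^{(j)}H_j*. (4.4.4)"*.

THE TORUS DATA and THE READING (kind «model instance»; conventions of the torus files, nothing new).  Tori of the series
(`Balaban1983to89.Setup`/`Params`: `d ≥ 1`, block size `L` odd `> 1`, standing range); the `η`-lattice of step `k` = level `0`
(`η`-bonds `PBond P 0`), the unit lattice `T₁^{(j)}` of step `j` = level `j` (`PBond P j`), as in p11's `DkE P w c k = Σ_{j<k} H_jC^{(j)}H_j*`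
((4.4.4), row C1.Eq4.4.4 / C2.Eq2.12) and p08's kernel reading of it (`dkKernel_eq_sum`): `H_j(b, b₁) := (H_je_{b₁})(b)` (`hKer`), `C^{(j)}(b₁,b₂)
:= ⟨e_{b₁}, C^{(j)}e_{b₂}⟩` (`cKer`), any weights `(w, c)` (the printed ones are `(η_k^d, L^k)`; by r18's dictionary `BIJ85Prop522Rescaling`
the weights only scale the kernels).  Distances: on `T₁^{(j)}` the `ℓ^∞` torus distance in units of `T₁^{(j)}`, `dist(b₁,b₂) := |b₁₋ −
b₂₋|_∞ = supDist b₁.src b₂.src` (`bdist`; the distance of p09's (7.2.3) reading `ineq723_torus`); between `T_η` and `T₁^{(j)}` p09's (7.2.2)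
distance `dist(b,b₁) := |b₋ − y_{b₁₋}|_∞/L^j = distEU P j b.src b₁.src` to the block centre (`hdist`; as in p08's `BIJ88HkLocTorus`); on
`T_η` in units of `T₁^{(k)}`, `dist_k(b,b″) := |b₋ − b″₋|_∞/L^k` (`kdist`; as in p08's `BIJ85CurlyDkDecayTorus`).  The cutoffs are p13's
CONSTRUCTED profiles `cutoff R₁ R₀ dist` ((2.1) with the printed radii `r(e_j)/16 < r(e_j)/8`), the truncation (2.8) is r18's `trunc` at the
printed radius `r(e_j)/4`, the sandwich (2.9) is p02's `clocKer` with p31's CONCRETE torus kernels `Q = qKer P j` ([I] (2.13) =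
`LatticeFieldCalculus.bondAvg`), `Q* = qstKer P j` (its (2.14)-adjoint), `Q^s = qsKer`, `Q^{s*} = qsstKer` of `torusBlockBonds P j` ([I]
(2.16)/(2.17)) — exactly the data of p31's `BIJ88Eq210Torus.eq210_torus`.  The radii enter through a SCHEDULE `ρ : ℕ → ℝ`, `ρ j = r(e_j)`; the
printed schedule is `rSched L ε e r d j = rLen r (eK L ε e d j)` ((2.2)–(2.3), r18's `BIJ88Sect2Statements`).

WHAT IS PROVED (kernel-checked; `def`s with bodies + theorems; 0 `sorry`; NO `Prop`-valued fact; standard axioms):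
* §1 **(2.8)** `ctKer w c R j = trunc bdist R (cKer w c j)` and its API (`ctKer_of_le`, `ctKer_of_not_le`, `abs_ctKer_le`: `|C̃| ≤ |C|`,
  `bdist_le_of_ctKer_ne_zero`).
* §2 **(2.9)** `clKer w c R j = clocKer Q Q* Q^s Q^{s*} (ctKer w c R j)` and **(2.10) for it** (`qKer_mul_clKer`, `clKer_mul_qstKer`: p31's
  theorems instantiated); **THE SUPPORT OF THE SANDWICH** (the geometry the print leaves implicit): `(I − Q^{s*}Q)(b₁,a) ≠ 0 ⟹ |b₁₋ − a₋|_∞ ≤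
  2L − 2` (`supDist_le_of_oneSubLeft_ne_zero`: `b₁` a surface bond of the coarse bond `c` and `a` on a straight run of `c`, both rooted in the
  block `B(c₋)`), the same on the right (`supDist_le_of_oneSubRight_ne_zero`), hence **`C^{(j)}_{loc}(b₁,b₂) ≠ 0 ⟹ |b₁₋ − b₂₋|_∞ ≤ R + (4L − 4)`**
  (`bdist_le_of_clKer_ne_zero`).
* §3 **(2.4) at every scale** `hlKer w c R₁ R₀ j = loc (cutoff R₁ R₀ hdist) (hKer w c j)` (= p08's torus `H_{j,loc}` with p13's cutoff, definitionally);
  `|H_{j,loc}| ≤ |H_j|` (`abs_hlKer_le`), `H_{j,loc}(b,b₁) = 0` for `dist(b,b₁) ≥ R₀` (`hlKer_eq_zero_of_le`, any `R₁ ≤ R₀`).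
* §4 **(2.12)** `dkLocKer w c ρ k b b″ = Σ_{j<k} Σ_{b₁,b₂ ∈ T^{(j)}} H_{j,loc}(b,b₁)·C^{(j)}_{loc}(b₁,b₂)·H_{j,loc}(b″,b₂)` with the printed radii
  `(ρ j/16, ρ j/8)` for `ζ_j`, `ρ j/4` for `C̃^{(j)}` — the kernel of (2.12) in the reading of (I.4.4.4) of record (same triple sum as p08's
  `dkKernel_eq_sum` with every factor localized: `dkLocKer_eq_sum`).
* §5 **«Furthermore, 𝒟_{k,loc}(b₁,b₂) = 0 for dist(b₁,b₂) ≧ ½r(e_k)» FOR THIS OBJECT**: the scale-`j` term vanishes for `|b₋ − b″₋|_∞ ≥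
  L^j(ρ_j/2 + 4L − 4)` (`term_eq_zero_of_far`: ranges `ρ_j/8 + (ρ_j/4 + 4L − 4) + ρ_j/8` in units of `T₁^{(j)}`, `|y_q − y_{q′}|_∞ = L^j|q − q′|_∞`);
  hence, for any schedule with `0 ≤ ρ_j` and `L^jρ_j ≤ L^kρ_k` (`j < k ≤ m + K`), **`dkLocKer w c ρ k b b″ = 0` whenever `dist_k(b,b″) ≥ ρ_k/2 + 4`**
  (`dkLocKer_eq_zero_of_far`, `vanishes_dkLocKer` = r18's typed `Vanishes kdist 𝒟_{k,loc} (ρ k/2 + 4)`), and for THE PRINTED SCHEDULE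
  (2.2)–(2.3) under p08's hypotheses of `rLen_scale_le` (`log e_k⁻¹ > 0`, `r(4−d)/2 ≤ log e_k⁻¹`, `0 ≤ r`, `d ≤ 4`): `vanishes_dkLocKer_rSched`.
* §6 (v1.1, append-only) **DICTIONARY WITH THE (2.8)/(2.9) TORUS OBJECTS OF RECORD** — OWNER RULING (HOME/lit-balaban-r18/ROWS-C2.md v1.72):
  p09's `BIJ88ClocFactorsTorus.Cmat`, `BIJ88ClocEstimatesTorus.Ctil`/`Cloc` (native weights `(η_j^d, L^j)`; landed first, p304084/p304299, WITH
  the p. 261 sentence «We have estimates analogous to (2.5)–(2.7) for C^{(k)}_{loc}» proved, `cloc_estimates`) ARE the torus objects of record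
  for `C^{(k)}`, `C̃^{(k)}`, `C^{(k)}_{loc}`; §§1–2 of this file are the same truncation and sandwich at FREE weights `(w, c)`, kept because (2.12)
  evaluates `C^{(j)}_{loc}` *"rescaled to nonstandard lattices"*, i.e. at the ambient weights `(η_k^d, L^k)` of step `k`.  At native weights the
  pairs COINCIDE definitionally (`cKer_native_eq_Cmat`, `ctKer_native_eq_Ctil`, `clKer_native_eq_Cloc`); at the ambient weights of step `k ≥ j`
  they are the `(L^{k−j})^{d−2}`-multiples (r18's `BIJ88Decay216Native.cE_ambient_eq_native`: `ctKer_ambient_eq`, `clKer_ambient_eq`); `H_{j,loc}`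
  does not see the weights at all (`hlKer_eq_hlKer_one`, r18's `BIJ85Prop522Rescaling.hkE_eq_hkE_one`); whence **(2.12) WRITTEN THROUGH THE
  OBJECTS OF RECORD**: `𝒟_{k,loc}(b,b″) = Σ_{j<k} (L^{k−j})^{d−2} Σ_{b₁,b₂} H_{j,loc}(b,b₁)·Cloc P j (ρ_j/4) b₁ b₂·H_{j,loc}(b″,b₂)` (`dkLocKer_eq_sum_Cloc`;
  with unit-weight minimizers `dkLocKer_eq_sum_Cloc_one`).  Consumers: cite p09's names for `C̃^{(k)}`, `C^{(k)}_{loc}` and their estimates, this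
  file's for `H_{j,loc}` (`hlKer`) and `𝒟_{k,loc}` (`dkLocKer`, `termKer`).
HONEST SCOPE.  (i) DEFINITIONS of record + support statements only: the decay (2.13), its derivative/Hölder clauses and «𝒟_{k,loc} is close
to 𝒟_k» (5.4.3) are NOT proved here for this object (p08's lane: `BIJ88MultiscaleDecay223Torus`, `BIJ88HolderDecay213Torus`, the unlocalized
inputs `BIJ85CurlyDk{Decay,Grad}Torus`).  (ii) The printed range «½r(e_k)» holds for this concrete object up to the ADDITIVE CONSTANT `4` (in
units of `T₁^{(k)}`): the sandwich `(I − Q^{s*}Q)·(I − Q*Q^s)` of (2.9) spreads supports by one block on each side (`4L − 4` fine steps of `T₁^{(j)}`,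
`≤ 4` units of `T₁^{(k)}` after rescaling, `j < k`) — the print's generic `O(1)` bookkeeping («c denotes constants that may change from line to
line», `r(e_k) → ∞`); nothing of the paper fails.  (iii) «extend by translation invariance to T₁^{(k)}» is automatic on the torus (the
kernels are defined on all of `T₁^{(j)}`).  (iv) `U = 1`, real abelian fields, tori of the series, standing range `k ≤ m + K` (so that every
`j < k` has a next level); weights `(w, c)` free.  (v) No smallness of `e_k` is used except through the displayed schedule hypotheses.
NOT summit progress.  Unit `lit-balaban-r18` (literature-prover-lit-balaban-r18-g10-0), 2026-08-21.
-/

open scoped BigOperators RealInnerProductSpace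

namespace Literature.MathematicalPhysics.QuantumFieldTheory.BalabanImbrieJaffe1984to88.BIJ88CurlyDkLocTorus

open Balaban1983to89 hiding Site Plaq
open Balaban1983to89.LatticeFieldCalculus
open BIJ85Prop521Torus BIJ85Prop522Torus
open BIJ85Ineq722Torus
open BIJ85Ineq723Torus (supDist_le_of_blockOf_eq)
open BIJ85Sect2SurfaceAverages BIJ85Eq219Proof BIJ85Eq213Adjoint BIJ88Eq211Proof
open BIJ88Eq210Torus (qKer_mul_clocKer clocKer_mul_qstKer)
open BIJ88Sect2Statements (trunc loc Vanishes rLen eK)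
open BIJ88Cutoffs21 (cutoff cutoffProfile cutoff_nonneg cutoff_le_one cutoffProfile_eq_zero)
open BIJ88HolderDecay213 (rLen_scale_le)
open B3TorusRadialSums (supDist_comm supDist_eq_zero_iff)
-- inside this namespace the bare `Site`/`Plaq` are the `ℤ^d` carriers of the QFT root; the torus ones are renamed:
open Balaban1983to89 renaming Site → TSite, Plaq → TPlaq

noncomputable section

variable {P : Params}

/-! ## §1  (2.8): the truncated covariance `C̃^{(j)}` of the torus `C^{(j)}` of record -/

/-- the matrix of the unit-lattice covariance of step `j`: `C^{(j)}(b₁, b₂) := ⟨e_{b₁}, C^{(j)}e_{b₂}⟩` for p11's operator `CE P w c j`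
((4.3.3) of [I]; the entries of p08's `dkKernel_eq_sum`). [cite: BalabanImbrieJaffe1985, (4.3.3) p.311] -/
def cKer (w c : ℝ) (j : ℕ) (b₁ b₂ : PBond P j) : ℝ :=
  ⟪toEj P j (Pi.single b₁ 1), CE P w c j (toEj P j (Pi.single b₂ 1))⟫

/-- the distance of (2.8) on `T₁^{(j)}`: `dist(b₁, b₂) := |b₁₋ − b₂₋|_∞` in units of `T₁^{(j)}` (the `ℓ^∞` torus distance of the sources,
as in p09's (7.2.3) reading). [cite: BalabanImbrieJaffe1988, (2.8) p.261] -/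
def bdist (j : ℕ) (b₁ b₂ : PBond P j) : ℝ := (supDist b₁.src b₂.src : ℝ)

/-- **(2.8) ON THE TORUS**: `C̃^{(j)}(b₁, b₂) = C^{(j)}(b₁, b₂)` if `dist(b₁, b₂) ≤ R`, `0` otherwise (print: `R = ¼r(e_j)`), for the torus
`C^{(j)}` of record — r18's `trunc` instantiated. [cite: BalabanImbrieJaffe1988, (2.8) p.261] -/
def ctKer (w c R : ℝ) (j : ℕ) : Matrix (PBond P j) (PBond P j) ℝ := trunc (bdist j) R (cKer (P := P) w c j)

/-- unfolding (2.8). [cite: BalabanImbrieJaffe1988, (2.8) p.261] -/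
theorem ctKer_apply (w c R : ℝ) (j : ℕ) (b₁ b₂ : PBond P j) :
    ctKer (P := P) w c R j b₁ b₂ = if bdist j b₁ b₂ ≤ R then cKer w c j b₁ b₂ else 0 := rfl

/-- (2.8), first case: within the radius `C̃^{(j)} = C^{(j)}`. [cite: BalabanImbrieJaffe1988, (2.8) p.261] -/
theorem ctKer_of_le {w c R : ℝ} {j : ℕ} {b₁ b₂ : PBond P j} (h : bdist j b₁ b₂ ≤ R) :
    ctKer (P := P) w c R j b₁ b₂ = cKer w c j b₁ b₂ := by
  rw [ctKer_apply, if_pos h]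

/-- (2.8), second case: beyond the radius `C̃^{(j)} = 0`. [cite: BalabanImbrieJaffe1988, (2.8) p.261] -/
theorem ctKer_of_not_le {w c R : ℝ} {j : ℕ} {b₁ b₂ : PBond P j} (h : ¬ bdist j b₁ b₂ ≤ R) :
    ctKer (P := P) w c R j b₁ b₂ = 0 := by
  rw [ctKer_apply, if_neg h]

/-- `|C̃^{(j)}(b₁, b₂)| ≤ |C^{(j)}(b₁, b₂)|` (a truncation only removes entries). [cite: BalabanImbrieJaffe1988, (2.8) p.261] -/
theorem abs_ctKer_le (w c R : ℝ) (j : ℕ) (b₁ b₂ : PBond P j) :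
    |ctKer (P := P) w c R j b₁ b₂| ≤ |cKer w c j b₁ b₂| := by
  rw [ctKer_apply]
  split_ifs
  · exact le_rfl
  · rw [abs_zero]; exact abs_nonneg _

/-- the support of `C̃^{(j)}`: `C̃^{(j)}(b₁, b₂) ≠ 0 ⟹ dist(b₁, b₂) ≤ R`. [cite: BalabanImbrieJaffe1988, (2.8) p.261] -/
theorem bdist_le_of_ctKer_ne_zero {w c R : ℝ} {j : ℕ} {b₁ b₂ : PBond P j} (h : ctKer (P := P) w c R j b₁ b₂ ≠ 0) :
    bdist j b₁ b₂ ≤ R := by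
  by_contra hR
  exact h (ctKer_of_not_le hR)

/-! ## §2  (2.9): the localized covariance `C^{(j)}_{loc}` with the concrete torus averages, (2.10), and its support -/

/-- **(2.9) ON THE TORUS**: `C^{(j)}_{loc} = (I − Q^{s*}Q)C̃^{(j)}(I − Q*Q^s)` — p02's kernel `clocKer` with p31's CONCRETE torus kernels
`Q = qKer P j` ([I] (2.13)), `Q* = qstKer P j` ((2.14)-adjoint), `Q^s = qsKer`, `Q^{s*} = qsstKer` of `torusBlockBonds P j` ([I] (2.16)/(2.17))
and the truncated covariance (2.8). [cite: BalabanImbrieJaffe1988, (2.9) p.261] -/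
def clKer (w c R : ℝ) (j : ℕ) : Matrix (PBond P j) (PBond P j) ℝ :=
  @clocKer (PBond P j) (PBond P (j + 1)) _ _ (fun a b => Classical.propDecidable (a = b))
    (qKer P j) (qstKer P j) (qsKer (torusBlockBonds P j)) (qsstKer (torusBlockBonds P j)) (ctKer w c R j)

/-- unfolding (2.9): `C^{(j)}_{loc} = (1 − Q^{s*}Q)·C̃^{(j)}·(1 − Q*Q^s)` as a product of torus matrices (the identity matrix taken, as in p31's
`BIJ88Eq210Torus`, with the classical decidability of equality of bonds). [cite: BalabanImbrieJaffe1988, (2.9) p.261] -/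
theorem clKer_eq (w c R : ℝ) (j : ℕ) :
    clKer (P := P) w c R j =
      haveI : DecidableEq (PBond P j) := fun a b => Classical.propDecidable (a = b)
      (1 - qsstKer (torusBlockBonds P j) * qKer P j) * ctKer w c R j * (1 - qstKer P j * qsKer (torusBlockBonds P j)) := rfl

/-- **(2.10), left: `QC^{(j)}_{loc} = 0`** for the torus `C^{(j)}_{loc}` (p31's `qKer_mul_clocKer`). [cite: BalabanImbrieJaffe1988, (2.10) p.261] -/
theorem qKer_mul_clKer {j : ℕ} (hj : j + 1 ≤ P.m + P.K) (w c R : ℝ) : qKer P j * clKer (P := P) w c R j = 0 :=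
  qKer_mul_clocKer hj _

/-- **(2.10), right: `C^{(j)}_{loc}Q* = 0`** for the torus `C^{(j)}_{loc}` (p31's `clocKer_mul_qstKer`). [cite: BalabanImbrieJaffe1988, (2.10) p.261] -/
theorem clKer_mul_qstKer {j : ℕ} (hj : j + 1 ≤ P.m + P.K) (w c R : ℝ) : clKer (P := P) w c R j * qstKer P j = 0 :=
  clocKer_mul_qstKer hj _

/-! ### The support of the (2.9) sandwich: one block on each side -/

/-- a coarse bond `c` sees a fine bond `a` in (2.13) only along the straight runs from `B(c₋)`: `runCount c a ≠ 0 ⟹ a = [x, x + e_μ]`-bond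
`t` of the run from some `x ∈ B(c₋)`, `t < L`. [cite: BalabanImbrieJaffe1985, (2.13) p.304] -/
theorem exists_run_of_runCount_ne_zero {j : ℕ} {c : PBond P (j + 1)} {a : PBond P j} (h : runCount c a ≠ 0) :
    ∃ (r : Fin P.d → Fin P.L) (t : ℕ), t < P.L ∧ runBond (TSite.blockSite c.src r) c.dir t = a := by
  classical
  unfold runCount at h
  obtain ⟨r, -, hr⟩ := Finset.exists_ne_zero_of_sum_ne_zero h
  obtain ⟨t, ht, hrt⟩ := Finset.exists_ne_zero_of_sum_ne_zero hr
  refine ⟨r, t, Finset.mem_range.1 ht, ?_⟩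
  by_contra hne
  exact hrt (if_neg hne)

/-- the runs of (2.13) stay within `2L − 2` of every point of the block `B(c₋)`: `runCount c a ≠ 0`, `x ∈ B(c₋)` ⟹ `|x − a₋|_∞ ≤ 2L − 2`
(`L − 1` inside the block, `t ≤ L − 1` along the run). [cite: BalabanImbrieJaffe1985, (2.13) p.304] -/
theorem supDist_le_of_runCount_ne_zero {j : ℕ} (hj : j + 1 ≤ P.m + P.K) {c : PBond P (j + 1)} {a : PBond P j}
    (h : runCount c a ≠ 0) {x : TSite P j} (hx : blockOf x = c.src) : supDist x a.src ≤ 2 * P.L - 2 := by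
  obtain ⟨r, t, ht, hrt⟩ := exists_run_of_runCount_ne_zero h
  have hsrc : a.src = runSite (TSite.blockSite c.src r) c.dir t := by rw [← hrt]; rfl
  have h1 : supDist x (TSite.blockSite c.src r) ≤ P.L - 1 :=
    supDist_le_of_blockOf_eq hj (by rw [hx, TSite.blockOf_blockSite hj])
  have h2 : supDist (TSite.blockSite c.src r) a.src ≤ t := by rw [hsrc]; exact supDist_runSite_le _ _ _
  have h3 := supDist_triangle x (TSite.blockSite c.src r) a.src
  have hL := P.L_pos
  omega

/-- a surface bond of `c` ([I] (2.15)) starts in the block `B(c₋)`. [cite: BalabanImbrieJaffe1985, (2.15) p.304] -/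
theorem blockOf_src_of_mem_Bs {j : ℕ} {b : PBond P j} {c : PBond P (j + 1)} (h : b ∈ (torusBlockBonds P j).Bs c) :
    blockOf b.src = c.src := by
  have h' := ((torusBlockBonds P j).mem_Bs c b).1 h
  exact h'.1

/-- **support of the left factor of (2.9)**: `(I − Q^{s*}Q)(b₁, a) ≠ 0 ⟹ |b₁₋ − a₋|_∞ ≤ 2L − 2` — either `a = b₁`, or `b₁ ∈ B^s(c)` and `a`
on a run of the same coarse bond `c`, both rooted in `B(c₋)`. [cite: BalabanImbrieJaffe1988, (2.9) p.261] -/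
theorem supDist_le_of_oneSubLeft_ne_zero {j : ℕ} {inst : DecidableEq (PBond P j)} (hj : j + 1 ≤ P.m + P.K) {b₁ a : PBond P j}
    (h : ((1 : Matrix (PBond P j) (PBond P j) ℝ) - qsstKer (torusBlockBonds P j) * qKer P j) b₁ a ≠ 0) :
    supDist b₁.src a.src ≤ 2 * P.L - 2 := by
  classical
  by_cases hba : b₁ = a
  · subst hba; rw [(supDist_eq_zero_iff _ _).2 rfl]; exact Nat.zero_le _
  · rw [Matrix.sub_apply, Matrix.one_apply_ne hba, zero_sub, neg_ne_zero, Matrix.mul_apply] at h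
    obtain ⟨c, -, hc⟩ := Finset.exists_ne_zero_of_sum_ne_zero h
    have hqsst : qsstKer (torusBlockBonds P j) b₁ c ≠ 0 := left_ne_zero_of_mul hc
    have hq : qKer P j c a ≠ 0 := right_ne_zero_of_mul hc
    have hmem : b₁ ∈ (torusBlockBonds P j).Bs c := by
      by_contra hn; exact hqsst (by simp [qsstKer, hn])
    have hrc : runCount c a ≠ 0 := by
      intro h0; exact hq (by simp [qKer, h0])
    exact supDist_le_of_runCount_ne_zero hj hrc (blockOf_src_of_mem_Bs hmem)

/-- **support of the right factor of (2.9)**: `(I − Q*Q^s)(a, b₂) ≠ 0 ⟹ |a₋ − b₂₋|_∞ ≤ 2L − 2` (`Q*(a, c) = L^dQ(c, a)`, `Q^s(c, b₂) ≠ 0` iff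
`b₂ ∈ B^s(c)`). [cite: BalabanImbrieJaffe1988, (2.9) p.261] -/
theorem supDist_le_of_oneSubRight_ne_zero {j : ℕ} {inst : DecidableEq (PBond P j)} (hj : j + 1 ≤ P.m + P.K) {a b₂ : PBond P j}
    (h : ((1 : Matrix (PBond P j) (PBond P j) ℝ) - qstKer P j * qsKer (torusBlockBonds P j)) a b₂ ≠ 0) :
    supDist a.src b₂.src ≤ 2 * P.L - 2 := by
  classical
  by_cases hba : a = b₂
  · subst hba; rw [(supDist_eq_zero_iff _ _).2 rfl]; exact Nat.zero_le _
  · rw [Matrix.sub_apply, Matrix.one_apply_ne hba, zero_sub, neg_ne_zero, Matrix.mul_apply] at h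
    obtain ⟨c, -, hc⟩ := Finset.exists_ne_zero_of_sum_ne_zero h
    have hqst : qstKer P j a c ≠ 0 := left_ne_zero_of_mul hc
    have hqs : qsKer (torusBlockBonds P j) c b₂ ≠ 0 := right_ne_zero_of_mul hc
    have hmem : b₂ ∈ (torusBlockBonds P j).Bs c := by
      by_contra hn; exact hqs (by simp [qsKer, hn])
    have hrc : runCount c a ≠ 0 := by
      intro h0; exact hqst (by simp [qstKer, qKer, h0])
    rw [supDist_comm]
    exact supDist_le_of_runCount_ne_zero hj hrc (blockOf_src_of_mem_Bs hmem)

/-- **THE SUPPORT OF `C^{(j)}_{loc}`**: `C^{(j)}_{loc}(b₁, b₂) ≠ 0 ⟹ dist(b₁, b₂) ≤ R + (4L − 4)` — the truncation radius of (2.8) plus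
one block of spread on each side from the averages in (2.9). [cite: BalabanImbrieJaffe1988, (2.9) p.261] -/
theorem bdist_le_of_clKer_ne_zero {j : ℕ} (hj : j + 1 ≤ P.m + P.K) {w c R : ℝ} {b₁ b₂ : PBond P j}
    (h : clKer (P := P) w c R j b₁ b₂ ≠ 0) : bdist j b₁ b₂ ≤ R + (4 * P.L - 4 : ℕ) := by
  unfold clKer clocKer at h
  rw [Matrix.mul_apply] at h
  obtain ⟨a', -, ha'⟩ := Finset.exists_ne_zero_of_sum_ne_zero h
  have hB := right_ne_zero_of_mul ha'
  have hAC := left_ne_zero_of_mul ha'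
  rw [Matrix.mul_apply] at hAC
  obtain ⟨a, -, ha⟩ := Finset.exists_ne_zero_of_sum_ne_zero hAC
  have hA := left_ne_zero_of_mul ha
  have hC : ctKer (P := P) w c R j a a' ≠ 0 := right_ne_zero_of_mul ha
  have h1 := supDist_le_of_oneSubLeft_ne_zero hj hA
  have h2 := bdist_le_of_ctKer_ne_zero hC
  have h3 := supDist_le_of_oneSubRight_ne_zero hj hB
  have h4 := supDist_triangle b₁.src a.src b₂.src
  have h5 := supDist_triangle a.src a'.src b₂.src
  unfold bdist at h2 ⊢
  have hL := P.L_pos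
  have h6 : (supDist b₁.src b₂.src : ℝ) ≤ (supDist b₁.src a.src : ℝ) + (supDist a.src a'.src : ℝ) + (supDist a'.src b₂.src : ℝ) := by
    exact_mod_cast h4.trans (Nat.add_le_add_left h5 _) |>.trans (le_of_eq (by ring))
  have h7 : ((supDist b₁.src a.src : ℕ) : ℝ) + (supDist a'.src b₂.src : ℝ) ≤ ((4 * P.L - 4 : ℕ) : ℝ) := by
    have : supDist b₁.src a.src + supDist a'.src b₂.src ≤ 4 * P.L - 4 := by omega
    exact_mod_cast this
  linarith

/-! ## §3  (2.4) at every scale `j`: the localized minimizers `H_{j,loc}` -/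

/-- the kernel of the Landau minimizer of scale `j` on the torus, `H_j(b, b₁) := (H_je_{b₁})(b)` (`b` an `η`-bond, `b₁ ∈ T₁^{(j)}`) for p11's
`HkE P w c j` — the (7.2.1)/(1.103) kernel (p08's `BIJ88HkLocTorus.ofLp_HkE_single_bond`), as in p08's `dkKernel_eq_sum`.
[cite: BalabanImbrieJaffe1985, (7.2.1) p.325] -/
def hKer (w c : ℝ) (j : ℕ) (b : PBond P 0) (b₁ : PBond P j) : ℝ := HkE P w c j (toEj P j (Pi.single b₁ 1)) b

/-- the distance of (2.1)/(2.4) between `T_η` and `T₁^{(j)}`: p09's (7.2.2) distance `|b₋ − y_{b₁₋}|_∞/L^j` to the block centre, in units of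
`T₁^{(j)}` (as in p08's `BIJ88HkLocTorus`). [cite: BalabanImbrieJaffe1988, (2.1) p.260] -/
def hdist (j : ℕ) (b : PBond P 0) (b₁ : PBond P j) : ℝ := distEU P j b.src b₁.src

/-- **(2.4) ON THE TORUS AT SCALE `j`**: `H_{j,loc}(b, b₁) = ζ_j(b, b₁)H_j(b, b₁)` with p13's CONSTRUCTED cutoff `ζ_j = cutoff R₁ R₀ dist` of (2.1)
(print: `R₁ = r(e_j)/16`, `R₀ = r(e_j)/8`) — r18's `loc`; definitionally the object of p08's `eq25_26_27_HkE_torus_unscaled_cutoff`.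
[cite: BalabanImbrieJaffe1988, (2.4) p.260] -/
def hlKer (w c R₁ R₀ : ℝ) (j : ℕ) : PBond P 0 → PBond P j → ℝ :=
  loc (cutoff R₁ R₀ (hdist (P := P) j)) (hKer w c j)

/-- unfolding (2.4). [cite: BalabanImbrieJaffe1988, (2.4) p.260] -/
theorem hlKer_apply (w c R₁ R₀ : ℝ) (j : ℕ) (b : PBond P 0) (b₁ : PBond P j) :
    hlKer (P := P) w c R₁ R₀ j b b₁ = cutoff R₁ R₀ (hdist (P := P) j) b b₁ * hKer w c j b b₁ := rfl

/-- `|H_{j,loc}(b, b₁)| ≤ |H_j(b, b₁)|` (`0 ≤ ζ_j ≤ 1`). [cite: BalabanImbrieJaffe1988, (2.5) p.260] -/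
theorem abs_hlKer_le (w c R₁ R₀ : ℝ) (j : ℕ) (b : PBond P 0) (b₁ : PBond P j) :
    |hlKer (P := P) w c R₁ R₀ j b b₁| ≤ |hKer w c j b b₁| := by
  rw [hlKer_apply, abs_mul]
  have h0 := cutoff_nonneg R₁ R₀ (hdist (P := P) j) b b₁
  have h1 := cutoff_le_one R₁ R₀ (hdist (P := P) j) b b₁
  rw [abs_of_nonneg h0]
  exact mul_le_of_le_one_left (abs_nonneg _) h1

/-- the cutoff profile vanishes beyond the outer radius also in the degenerate case `R₁ = R₀` (then it vanishes identically).
[cite: BalabanImbrieJaffe1988, (2.1) p.260] -/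
theorem cutoffProfile_eq_zero_of_le {R₁ R₀ t : ℝ} (hR : R₁ ≤ R₀) (ht : R₀ ≤ t) : cutoffProfile R₁ R₀ t = 0 := by
  rcases hR.lt_or_eq with hlt | heq
  · exact cutoffProfile_eq_zero hlt ht
  · unfold cutoffProfile
    rw [heq, sub_self, div_zero]
    exact Real.smoothTransition.zero_of_nonpos le_rfl

/-- **(2.6)-shape at scale `j`: `H_{j,loc}(b, b₁) = 0` for `dist(b, b₁) ≥ R₀`** (any `R₁ ≤ R₀`). [cite: BalabanImbrieJaffe1988, (2.6) p.260] -/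
theorem hlKer_eq_zero_of_le {w c R₁ R₀ : ℝ} (hR : R₁ ≤ R₀) {j : ℕ} {b : PBond P 0} {b₁ : PBond P j} (h : R₀ ≤ hdist (P := P) j b b₁) :
    hlKer (P := P) w c R₁ R₀ j b b₁ = 0 := by
  rw [hlKer_apply, BIJ88Cutoffs21.cutoff_apply]
  have : cutoffProfile R₁ R₀ (hdist (P := P) j b b₁) = 0 := cutoffProfile_eq_zero_of_le hR h
  unfold cutoffProfile at this
  rw [this, zero_mul]

/-- contrapositive: `H_{j,loc}(b, b₁) ≠ 0 ⟹ dist(b, b₁) < R₀`. [cite: BalabanImbrieJaffe1988, (2.6) p.260] -/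
theorem hdist_lt_of_hlKer_ne_zero {w c R₁ R₀ : ℝ} (hR : R₁ ≤ R₀) {j : ℕ} {b : PBond P 0} {b₁ : PBond P j}
    (h : hlKer (P := P) w c R₁ R₀ j b b₁ ≠ 0) : hdist (P := P) j b b₁ < R₀ := by
  by_contra hle
  exact h (hlKer_eq_zero_of_le hR (not_lt.1 hle))

/-! ## §4  (2.12): the kernel of `𝒟_{k,loc}` -/

/-- **(2.12) ON THE TORUS**: the kernel of the localized propagator `𝒟_{k,loc} = Σ_{j<k} H_{j,loc}C^{(j)}_{loc}H*_{j,loc}`,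
`𝒟_{k,loc}(b, b″) = Σ_{j<k} Σ_{b₁,b₂∈T^{(j)}} H_{j,loc}(b, b₁)·C^{(j)}_{loc}(b₁, b₂)·H_{j,loc}(b″, b₂)` (`b`, `b″` `η`-bonds) — the triple sum of (I.4.4.4)
of record (p08's `dkKernel_eq_sum`) with every factor localized at its own scale: `ζ_j` of radii `(ρ_j/16, ρ_j/8)` ((2.1)), `C̃^{(j)}` of radius
`ρ_j/4` ((2.8)), `ρ_j = r(e_j)` the radius SCHEDULE. [cite: BalabanImbrieJaffe1988, (2.12) p.261] -/
def dkLocKer (w c : ℝ) (ρ : ℕ → ℝ) (k : ℕ) (b b'' : PBond P 0) : ℝ :=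
  ∑ j ∈ Finset.range k, ∑ b₁ : PBond P j, ∑ b₂ : PBond P j,
    hlKer w c (ρ j / 16) (ρ j / 8) j b b₁ * clKer w c (ρ j / 4) j b₁ b₂ * hlKer w c (ρ j / 16) (ρ j / 8) j b'' b₂

/-- the scale-`j` term `G^{(j),η}_{loc}(b, b″) = Σ_{b₁,b₂} H_{j,loc}(b, b₁)C^{(j)}_{loc}(b₁, b₂)H_{j,loc}(b″, b₂)` of (2.12).
[cite: BalabanImbrieJaffe1988, (2.12) p.261] -/
def termKer (w c : ℝ) (ρ : ℕ → ℝ) (j : ℕ) (b b'' : PBond P 0) : ℝ :=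
  ∑ b₁ : PBond P j, ∑ b₂ : PBond P j,
    hlKer w c (ρ j / 16) (ρ j / 8) j b b₁ * clKer w c (ρ j / 4) j b₁ b₂ * hlKer w c (ρ j / 16) (ρ j / 8) j b'' b₂

/-- (2.12) as the sum of its scale terms `≡ Σ_{j<k} G^{(j),η}_{loc}`. [cite: BalabanImbrieJaffe1988, (2.12) p.261] -/
theorem dkLocKer_eq_sum (w c : ℝ) (ρ : ℕ → ℝ) (k : ℕ) (b b'' : PBond P 0) :
    dkLocKer (P := P) w c ρ k b b'' = ∑ j ∈ Finset.range k, termKer w c ρ j b b'' := rfl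

/-- the recursion in `k` (cf. (5.5.11) p. 285: `𝒟_{k+1,loc} = 𝒟_{k,loc} + H_{k,loc}C^{(k)}_{loc}H*_{k,loc}`), entrywise.
[cite: BalabanImbrieJaffe1988, (2.12) p.261] -/
theorem dkLocKer_succ (w c : ℝ) (ρ : ℕ → ℝ) (k : ℕ) (b b'' : PBond P 0) :
    dkLocKer (P := P) w c ρ (k + 1) b b'' = dkLocKer w c ρ k b b'' + termKer w c ρ k b b'' := by
  rw [dkLocKer_eq_sum, dkLocKer_eq_sum, Finset.sum_range_succ]

/-- the printed radius schedule (2.2)–(2.3): `ρ_j = r(e_j) = |log e_j⁻¹|^r`, `e_j = (L^jε)^{(4−d)/2}e` (r18's `rLen`/`eK`).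
[cite: BalabanImbrieJaffe1988, (2.3) p.260] -/
def rSched (L ε e r : ℝ) (d : ℕ) : ℕ → ℝ := fun j => rLen r (eK L ε e d j)

/-! ## §5  «Furthermore, 𝒟_{k,loc}(b₁,b₂) = 0 for dist(b₁,b₂) ≧ ½r(e_k)» for the concrete object -/

/-- the distance of the display on `T_η` in units of `T₁^{(k)}`: `dist_k(b, b″) := |b₋ − b″₋|_∞/L^k` (as in p08's `BIJ85CurlyDkDecayTorus`).
[cite: BalabanImbrieJaffe1988, (2.13) p.261] -/
def kdist (k : ℕ) (b b'' : PBond P 0) : ℝ := (supDist b.src b''.src : ℝ) / (P.L : ℝ) ^ k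

/-- `0 < L^n` on the tori. [folklore] -/
private theorem cast_pow_L_pos (n : ℕ) : (0 : ℝ) < (P.L : ℝ) ^ n := pow_pos P.cast_L_pos n

/-- **the range of the scale-`j` term**: for `0 ≤ ρ_j` and `j + 1 ≤ m + K`, `G^{(j),η}_{loc}(b, b″) = 0` whenever `|b₋ − b″₋|_∞ ≥ L^j(ρ_j/2 + 4L − 4)`
— the ranges `ρ_j/8` of `ζ_j` (twice), `ρ_j/4 + (4L − 4)` of `C^{(j)}_{loc}` in units of `T₁^{(j)}` add up along `b₋ → y_{b₁₋} → y_{b₂₋} → b″₋`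
(`|y_q − y_{q′}|_∞ = L^j|q − q′|_∞`). [cite: BalabanImbrieJaffe1988, (2.13) p.261] -/
theorem termKer_eq_zero_of_far {w c : ℝ} {ρ : ℕ → ℝ} {j : ℕ} (hj : j + 1 ≤ P.m + P.K) (hρ : 0 ≤ ρ j) {b b'' : PBond P 0}
    (hfar : (P.L : ℝ) ^ j * (ρ j / 2 + (4 * P.L - 4 : ℕ)) ≤ (supDist b.src b''.src : ℝ)) :
    termKer (P := P) w c ρ j b b'' = 0 := by
  have hj' : j ≤ P.m + P.K := by omega
  have hR : ρ j / 16 ≤ ρ j / 8 := by linarith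
  have hLj := cast_pow_L_pos (P := P) j
  unfold termKer
  refine Finset.sum_eq_zero fun b₁ _ => Finset.sum_eq_zero fun b₂ _ => ?_
  by_contra hne
  have h1 : hlKer (P := P) w c (ρ j / 16) (ρ j / 8) j b b₁ ≠ 0 := left_ne_zero_of_mul (left_ne_zero_of_mul hne)
  have h2 : clKer (P := P) w c (ρ j / 4) j b₁ b₂ ≠ 0 := right_ne_zero_of_mul (left_ne_zero_of_mul hne)
  have h3 : hlKer (P := P) w c (ρ j / 16) (ρ j / 8) j b'' b₂ ≠ 0 := right_ne_zero_of_mul hne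
  have d1 := hdist_lt_of_hlKer_ne_zero hR h1
  have d2 := bdist_le_of_clKer_ne_zero hj h2
  have d3 := hdist_lt_of_hlKer_ne_zero hR h3
  unfold hdist distEU at d1 d3
  unfold bdist at d2
  rw [div_lt_iff₀ hLj] at d1 d3
  -- the three legs in fine lattice steps
  have e2 : (supDist (ctr j b₁.src) (ctr j b₂.src) : ℝ) = (P.L : ℝ) ^ j * (supDist b₁.src b₂.src : ℝ) := by
    rw [supDist_ctr_ctr hj']; push_cast; ring
  have t1 := supDist_triangle b.src (ctr j b₁.src) b''.src
  have t2 := supDist_triangle (ctr j b₁.src) (ctr j b₂.src) b''.src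
  have t3 : supDist (ctr j b₂.src) b''.src = supDist b''.src (ctr j b₂.src) := supDist_comm _ _
  have hsum : (supDist b.src b''.src : ℝ) ≤ (supDist b.src (ctr j b₁.src) : ℝ) + (supDist (ctr j b₁.src) (ctr j b₂.src) : ℝ)
      + (supDist b''.src (ctr j b₂.src) : ℝ) := by
    rw [← t3]; exact_mod_cast t1.trans (by omega)
  rw [e2] at hsum
  have hmid : (P.L : ℝ) ^ j * (supDist b₁.src b₂.src : ℝ) ≤ (P.L : ℝ) ^ j * (ρ j / 4 + ((4 * P.L - 4 : ℕ) : ℝ)) :=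
    mul_le_mul_of_nonneg_left d2 hLj.le
  have key : (supDist b.src b''.src : ℝ) < (P.L : ℝ) ^ j * (ρ j / 2 + ((4 * P.L - 4 : ℕ) : ℝ)) := by
    have := add_lt_add (add_lt_add_of_lt_of_le d1 hmid) d3
    nlinarith
  exact absurd hfar (not_le.2 key)

/-- **«𝒟_{k,loc}(b₁,b₂) = 0 for dist(b₁,b₂) ≧ ½r(e_k)» FOR THE CONCRETE (2.12)**: for a radius schedule with `0 ≤ ρ_j` and the scale
monotonicity `L^jρ_j ≤ L^kρ_k` (`j < k`; (2.2)–(2.3)) and `k ≤ m + K`, `𝒟_{k,loc}(b, b″) = 0` whenever `dist_k(b, b″) ≥ ρ_k/2 + 4` — the printed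
`½r(e_k)` plus the one-block spread of the (2.9) averages (`L^j(4L − 4) ≤ 4L^k` for `j < k`). [cite: BalabanImbrieJaffe1988, (2.13) p.261] -/
theorem dkLocKer_eq_zero_of_far {w c : ℝ} {ρ : ℕ → ℝ} {k : ℕ} (hk : k ≤ P.m + P.K) (hρ0 : ∀ j < k, 0 ≤ ρ j)
    (hρ : ∀ j < k, (P.L : ℝ) ^ j * ρ j ≤ (P.L : ℝ) ^ k * ρ k) {b b'' : PBond P 0} (hfar : ρ k / 2 + 4 ≤ kdist (P := P) k b b'') :
    dkLocKer (P := P) w c ρ k b b'' = 0 := by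
  have hLk := cast_pow_L_pos (P := P) k
  unfold kdist at hfar
  rw [le_div_iff₀ hLk] at hfar
  rw [dkLocKer_eq_sum]
  refine Finset.sum_eq_zero fun j hj => ?_
  rw [Finset.mem_range] at hj
  refine termKer_eq_zero_of_far (by omega) (hρ0 j hj) (le_trans ?_ hfar)
  have hLj := cast_pow_L_pos (P := P) j
  have hL1 : (1 : ℝ) ≤ P.L := by exact_mod_cast P.L_pos
  have hmono := hρ j hj
  -- L^j(4L − 4) ≤ 4L^k since L^{j+1} ≤ L^k
  have hpow : (P.L : ℝ) ^ (j + 1) ≤ (P.L : ℝ) ^ k := pow_le_pow_right₀ hL1 (by omega)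
  have hcast : ((4 * P.L - 4 : ℕ) : ℝ) = 4 * (P.L : ℝ) - 4 := by
    have : 4 ≤ 4 * P.L := by have := P.L_pos; omega
    push_cast [Nat.cast_sub this]
    ring
  rw [hcast]
  rw [pow_succ] at hpow
  nlinarith

/-- the same in r18's typed vocabulary: **`Vanishes dist_k 𝒟_{k,loc} (ρ_k/2 + 4)`** (row C2.Eq2.13's second clause for the concrete object).
[cite: BalabanImbrieJaffe1988, (2.13) p.261] -/
theorem vanishes_dkLocKer {w c : ℝ} {ρ : ℕ → ℝ} {k : ℕ} (hk : k ≤ P.m + P.K) (hρ0 : ∀ j < k, 0 ≤ ρ j)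
    (hρ : ∀ j < k, (P.L : ℝ) ^ j * ρ j ≤ (P.L : ℝ) ^ k * ρ k) :
    Vanishes (kdist (P := P) k) (dkLocKer (P := P) w c ρ k) (ρ k / 2 + 4) :=
  fun _ _ h => dkLocKer_eq_zero_of_far hk hρ0 hρ h

/-- `r(e) = |log e⁻¹|^r ≥ 0`. [cite: BalabanImbrieJaffe1988, (2.3) p.260] -/
theorem rLen_nonneg (r e : ℝ) : 0 ≤ rLen r e := Real.rpow_nonneg (abs_nonneg _) _

/-- **THE PRINTED SCHEDULE**: with `ρ_j = r(e_j)`, `e_j = (L^jε)^{(4−d)/2}e` ((2.2)–(2.3)) on a torus of block size `L`, under p08's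
hypotheses of `rLen_scale_le` (`0 < log e_k⁻¹`, `r(4 − d)/2 ≤ log e_k⁻¹` — small `e_k`; `0 ≤ r`, `d ≤ 4`, `ε, e > 0`) the scale monotonicity
`L^jr(e_j) ≤ L^kr(e_k)` holds, so **`𝒟_{k,loc}(b, b″) = 0` for `dist_k(b, b″) ≥ ½r(e_k) + 4`**. [cite: BalabanImbrieJaffe1988, (2.13) p.261] -/
theorem vanishes_dkLocKer_rSched {w c ε e r : ℝ} {d k : ℕ} (hk : k ≤ P.m + P.K) (hε : 0 < ε) (he : 0 < e) (hr : 0 ≤ r) (hd : d ≤ 4)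
    (hℓ : 0 < Real.log (eK (P.L : ℝ) ε e d k)⁻¹) (hsmall : r * ((4 - (d : ℝ)) / 2) ≤ Real.log (eK (P.L : ℝ) ε e d k)⁻¹) :
    Vanishes (kdist (P := P) k) (dkLocKer (P := P) w c (rSched (P.L : ℝ) ε e r d) k) (rSched (P.L : ℝ) ε e r d k / 2 + 4) := by
  have hL : (1 : ℝ) < P.L := by exact_mod_cast P.hL.2
  refine vanishes_dkLocKer hk (fun j _ => rLen_nonneg _ _) fun j hj => ?_
  have h := rLen_scale_le hL hε he hr hd hj.le hℓ hsmall
  -- r(e_j) ≤ L^{k−j} r(e_k)  ⟹  L^j r(e_j) ≤ L^k r(e_k)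
  unfold rSched
  have hLj := cast_pow_L_pos (P := P) j
  calc (P.L : ℝ) ^ j * rLen r (eK (P.L : ℝ) ε e d j)
      ≤ (P.L : ℝ) ^ j * ((P.L : ℝ) ^ (k - j) * rLen r (eK (P.L : ℝ) ε e d k)) := mul_le_mul_of_nonneg_left h hLj.le
    _ = (P.L : ℝ) ^ k * rLen r (eK (P.L : ℝ) ε e d k) := by
        rw [← mul_assoc, ← pow_add, Nat.add_sub_cancel' hj.le]

/-! ## §6 (v1.1)  Dictionary with the (2.8)/(2.9) torus objects OF RECORD

OWNER RULING (r18 gen 10, `HOME/lit-balaban-r18/ROWS-C2.md` v1.72).  The (2.8)/(2.9) torus objects of record are p09's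
`BIJ88ClocFactorsTorus.Cmat` (the matrix of `C^{(k)}`), `BIJ88ClocEstimatesTorus.Ctil` (`C̃^{(k)}`, (2.8)) and `BIJ88ClocEstimatesTorus.Cloc`
(`C^{(k)}_{loc}`, (2.9)), at the native weights `(η_j^d, L^j)` — landed first (p304084, p304299) together with the located p. 261 sentence
*"We have estimates analogous to (2.5)–(2.7) for C^{(k)}_{loc}"* (`cloc_estimates`).  §§1–2 above are the SAME truncation and sandwich at free
weights `(w, c)`; they are kept (p304403 landed) because (2.12) evaluates `C^{(j)}_{loc}` on the `L^jη`-lattice of step `k` (*"Superscripts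
L^jη, η, etc. indicate the lattice spacing for operators rescaled to nonstandard lattices"*, p. 261), i.e. at the ambient weights `(η_k^d, L^k)`.
This section is the dictionary, so that no consumer has to choose: cite p09's names for `C̃^{(k)}`, `C^{(k)}_{loc}` and their estimates, and
this file's for `H_{j,loc}` and `𝒟_{k,loc}`. -/

open BIJ88ClocFactorsTorus (Cmat distB)
open BIJ88ClocEstimatesTorus (Ctil Cloc Ctil_apply)
open BIJ88Decay216Native (inner_cE_ambient_eq)
open BIJ85Prop522Rescaling (hkE_eq_hkE_one)

/-- the (2.8) distance of this file is p09's `distB` (both `|b₁₋ − b₂₋|_∞` in `T₁^{(j)}` units). [cite: BalabanImbrieJaffe1988, (2.8) p.261] -/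
theorem bdist_eq_distB (j : ℕ) : bdist (P := P) j = distB P j := rfl

/-- **at native weights the matrix of this file IS the `C^{(k)}` of record**: `cKer (η_j^d) (L^j) j = Cmat P j`, definitionally.
[cite: BalabanImbrieJaffe1988, (2.8) p.261] -/
theorem cKer_native_eq_Cmat (j : ℕ) : cKer (P := P) ((P.eta j) ^ P.d) ((P.L : ℝ) ^ j) j = Cmat P j := rfl

/-- **at native weights (2.8) of this file IS the `C̃^{(k)}` of record**: `ctKer (η_j^d) (L^j) R j = Ctil P j R`, definitionally.
[cite: BalabanImbrieJaffe1988, (2.8) p.261] -/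
theorem ctKer_native_eq_Ctil (j : ℕ) (R : ℝ) : ctKer (P := P) ((P.eta j) ^ P.d) ((P.L : ℝ) ^ j) R j = Ctil P j R := rfl

/-- `clKer` is p02's sandwich `clocKer` of the concrete torus kernels for WHICHEVER decidability instance builds the identity matrices (the
instance pinned in the definition is immaterial). [cite: BalabanImbrieJaffe1988, (2.9) p.261] -/
theorem clKer_eq_clocKer {j : ℕ} (inst : DecidableEq (PBond P j)) (w c R : ℝ) :
    clKer (P := P) w c R j = @clocKer (PBond P j) (PBond P (j + 1)) _ _ inst (qKer P j) (qstKer P j)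
      (qsKer (torusBlockBonds P j)) (qsstKer (torusBlockBonds P j)) (ctKer (P := P) w c R j) := by
  have h : inst = fun a b => Classical.propDecidable (a = b) := Subsingleton.elim _ _
  subst h
  rfl

/-- **at native weights (2.9) of this file IS the `C^{(k)}_{loc}` of record**: `clKer (η_j^d) (L^j) R j = Cloc P j R`.
[cite: BalabanImbrieJaffe1988, (2.9) p.261] -/
theorem clKer_native_eq_Cloc (j : ℕ) (R : ℝ) : clKer (P := P) ((P.eta j) ^ P.d) ((P.L : ℝ) ^ j) R j = Cloc P j R := by
  rw [clKer_eq_clocKer inferInstance]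
  rfl

/-- **the rescaling to the `L^jη`-lattice of step `k ≥ j`** (p. 261 *"operators rescaled to nonstandard lattices"*; r18's `cE_ambient_eq_native`):
`C^{(j),L^jη}(b₁,b₂) = (L^{k−j})^{d−2}·C^{(j)}(b₁,b₂)` — the matrix at the ambient weights `(η_k^d, L^k)` is the `(L^{k−j})^{d−2}`-multiple of the
matrix of record (no factor at `d = 2`). [cite: BalabanImbrieJaffe1988, (2.12) p.261] -/
theorem cKer_ambient_eq (hd : 2 ≤ P.d) {j k : ℕ} (hjk : j ≤ k) (b₁ b₂ : PBond P j) :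
    cKer (P := P) ((P.eta k) ^ P.d) ((P.L : ℝ) ^ k) j b₁ b₂ = ((P.L : ℝ) ^ (k - j)) ^ (P.d - 2) * Cmat P j b₁ b₂ :=
  inner_cE_ambient_eq hd hjk b₁ b₂

/-- the same for (2.8): `C̃^{(j),L^jη}(b₁,b₂) = (L^{k−j})^{d−2}·C̃^{(j)}(b₁,b₂)` (truncation commutes with scalars).
[cite: BalabanImbrieJaffe1988, (2.8) p.261] -/
theorem ctKer_ambient_eq (hd : 2 ≤ P.d) {j k : ℕ} (hjk : j ≤ k) (R : ℝ) (b₁ b₂ : PBond P j) :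
    ctKer (P := P) ((P.eta k) ^ P.d) ((P.L : ℝ) ^ k) R j b₁ b₂ = ((P.L : ℝ) ^ (k - j)) ^ (P.d - 2) * Ctil P j R b₁ b₂ := by
  rw [ctKer_apply, Ctil_apply, show distB P j b₁ b₂ = bdist j b₁ b₂ from rfl]
  split_ifs with h
  · exact cKer_ambient_eq hd hjk b₁ b₂
  · exact (mul_zero _).symm

/-- (2.8) at the ambient weights as a matrix identity: `ctKer (η_k^d) (L^k) R j = (L^{k−j})^{d−2} • Ctil P j R`. [cite: BalabanImbrieJaffe1988, (2.8) p.261] -/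
theorem ctKer_ambient_eq_smul (hd : 2 ≤ P.d) {j k : ℕ} (hjk : j ≤ k) (R : ℝ) :
    ctKer (P := P) ((P.eta k) ^ P.d) ((P.L : ℝ) ^ k) R j = (((P.L : ℝ) ^ (k - j)) ^ (P.d - 2)) • Ctil P j R := by
  ext b₁ b₂
  rw [Matrix.smul_apply, smul_eq_mul]
  exact ctKer_ambient_eq hd hjk R b₁ b₂

/-- p02's (2.9) sandwich commutes with scalars: `(1 − Q^{s*}Q)(aC̃)(1 − Q*Q^s) = a·(1 − Q^{s*}Q)C̃(1 − Q*Q^s)`. [cite: BalabanImbrieJaffe1988, (2.9) p.261] -/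
theorem clocKer_smul {β κ : Type*} [Fintype β] [Fintype κ] [DecidableEq β] (q : Matrix κ β ℝ) (qst : Matrix β κ ℝ)
    (qs : Matrix κ β ℝ) (qsst : Matrix β κ ℝ) (a : ℝ) (Ct : Matrix β β ℝ) :
    clocKer q qst qs qsst (a • Ct) = a • clocKer q qst qs qsst Ct := by
  unfold clocKer
  rw [Matrix.mul_smul, Matrix.smul_mul]

/-- **(2.9) at the ambient weights of step `k ≥ j`**: `C^{(j),L^jη}_{loc} = (L^{k−j})^{d−2}·C^{(j)}_{loc}` — `clKer (η_k^d) (L^k) R j` is the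
`(L^{k−j})^{d−2}`-multiple of the `C^{(k)}_{loc}` OF RECORD `Cloc P j R`. [cite: BalabanImbrieJaffe1988, (2.9) p.261] -/
theorem clKer_ambient_eq (hd : 2 ≤ P.d) {j k : ℕ} (hjk : j ≤ k) (R : ℝ) :
    clKer (P := P) ((P.eta k) ^ P.d) ((P.L : ℝ) ^ k) R j = (((P.L : ℝ) ^ (k - j)) ^ (P.d - 2)) • Cloc P j R := by
  rw [clKer_eq_clocKer inferInstance, ctKer_ambient_eq_smul hd hjk R, clocKer_smul]
  rfl

/-- (2.9) at the ambient weights, entrywise. [cite: BalabanImbrieJaffe1988, (2.9) p.261] -/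
theorem clKer_ambient_eq_apply (hd : 2 ≤ P.d) {j k : ℕ} (hjk : j ≤ k) (R : ℝ) (b₁ b₂ : PBond P j) :
    clKer (P := P) ((P.eta k) ^ P.d) ((P.L : ℝ) ^ k) R j b₁ b₂ = ((P.L : ℝ) ^ (k - j)) ^ (P.d - 2) * Cloc P j R b₁ b₂ := by
  rw [clKer_ambient_eq hd hjk R, Matrix.smul_apply, smul_eq_mul]

/-- **the minimizer kernels do not see the weights**: `hKer w c j = hKer 1 1 j` for `w > 0`, `c ≠ 0`, `j ≤ m + K` (r18's `hkE_eq_hkE_one`: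
`H_j` is the Landau minimizer, independent of the normalisation of the quadratic form). [cite: BalabanImbrieJaffe1985, (7.2.1) p.325] -/
theorem hKer_eq_hKer_one {j : ℕ} (hj : j ≤ P.m + P.K) {w c : ℝ} (hw : 0 < w) (hc : c ≠ 0) :
    hKer (P := P) w c j = hKer (P := P) 1 1 j := by
  funext b b₁
  unfold hKer
  rw [hkE_eq_hkE_one hj hw hc]

/-- hence neither does (2.4): `hlKer w c R₁ R₀ j = hlKer 1 1 R₁ R₀ j`. [cite: BalabanImbrieJaffe1988, (2.4) p.260] -/
theorem hlKer_eq_hlKer_one {j : ℕ} (hj : j ≤ P.m + P.K) {w c : ℝ} (hw : 0 < w) (hc : c ≠ 0) (R₁ R₀ : ℝ) :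
    hlKer (P := P) w c R₁ R₀ j = hlKer (P := P) 1 1 R₁ R₀ j := by
  unfold hlKer
  rw [hKer_eq_hKer_one hj hw hc]

/-- **(2.12) WRITTEN THROUGH THE OBJECTS OF RECORD**: at the printed weights `(η_k^d, L^k)`,
`𝒟_{k,loc}(b,b″) = Σ_{j<k} (L^{k−j})^{d−2} Σ_{b₁,b₂∈T^{(j)}} H_{j,loc}(b,b₁)·C^{(j)}_{loc}(b₁,b₂)·H_{j,loc}(b″,b₂)` with `C^{(j)}_{loc} = Cloc P j (ρ_j/4)`
p09's (2.9) OF RECORD and the `(L^{k−j})^{d−2}` of the rescaling to the `L^jη`-lattice (none at `d = 2`). [cite: BalabanImbrieJaffe1988, (2.12) p.261] -/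
theorem dkLocKer_eq_sum_Cloc (hd : 2 ≤ P.d) (ρ : ℕ → ℝ) (k : ℕ) (b b'' : PBond P 0) :
    dkLocKer (P := P) ((P.eta k) ^ P.d) ((P.L : ℝ) ^ k) ρ k b b'' =
      ∑ j ∈ Finset.range k, ((P.L : ℝ) ^ (k - j)) ^ (P.d - 2) *
        ∑ b₁ : PBond P j, ∑ b₂ : PBond P j,
          hlKer (P := P) ((P.eta k) ^ P.d) ((P.L : ℝ) ^ k) (ρ j / 16) (ρ j / 8) j b b₁ * Cloc P j (ρ j / 4) b₁ b₂ *
            hlKer (P := P) ((P.eta k) ^ P.d) ((P.L : ℝ) ^ k) (ρ j / 16) (ρ j / 8) j b'' b₂ := by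
  unfold dkLocKer
  refine Finset.sum_congr rfl fun j hj => ?_
  have hjk : j ≤ k := (Finset.mem_range.1 hj).le
  rw [Finset.mul_sum]
  refine Finset.sum_congr rfl fun b₁ _ => ?_
  rw [Finset.mul_sum]
  refine Finset.sum_congr rfl fun b₂ _ => ?_
  rw [clKer_ambient_eq_apply hd hjk]
  ring

/-- the same with the minimizers at unit weights (`H_{j,loc}` is weight-blind, `hlKer_eq_hlKer_one`; `k ≤ m + K`):
`𝒟_{k,loc}(b,b″) = Σ_{j<k} (L^{k−j})^{d−2} Σ_{b₁,b₂} H^{(1,1)}_{j,loc}(b,b₁)·Cloc P j (ρ_j/4) b₁ b₂·H^{(1,1)}_{j,loc}(b″,b₂)`. [cite: BalabanImbrieJaffe1988, (2.12) p.261] -/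
theorem dkLocKer_eq_sum_Cloc_one (hd : 2 ≤ P.d) {k : ℕ} (hk : k ≤ P.m + P.K) (ρ : ℕ → ℝ) (b b'' : PBond P 0) :
    dkLocKer (P := P) ((P.eta k) ^ P.d) ((P.L : ℝ) ^ k) ρ k b b'' =
      ∑ j ∈ Finset.range k, ((P.L : ℝ) ^ (k - j)) ^ (P.d - 2) *
        ∑ b₁ : PBond P j, ∑ b₂ : PBond P j,
          hlKer (P := P) 1 1 (ρ j / 16) (ρ j / 8) j b b₁ * Cloc P j (ρ j / 4) b₁ b₂ * hlKer (P := P) 1 1 (ρ j / 16) (ρ j / 8) j b'' b₂ := by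
  rw [dkLocKer_eq_sum_Cloc hd]
  refine Finset.sum_congr rfl fun j hj => ?_
  have hjk : j + 1 ≤ k := Finset.mem_range.1 hj
  have hη : 0 < (P.eta k) ^ P.d := pow_pos (pow_pos (inv_pos.2 P.cast_L_pos) k) _
  rw [hlKer_eq_hlKer_one ((Nat.le_of_succ_le hjk).trans hk) hη (pow_ne_zero k P.cast_L_pos.ne')]

end

end Literature.MathematicalPhysics.QuantumFieldTheory.BalabanImbrieJaffe1984to88.BIJ88CurlyDkLocTorus
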